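import Mathlib
import Literature.Analysis.FluidPDE.ClassicalSolutionRescale
import Summits.NavierStokesRegularity.NavierStokesRegularity.Theorems.LandauTailLandauTailBlowupShellEnergyFloor
import Summits.NavierStokesRegularity.NavierStokesRegularity.Theorems.LandauTailLandauTailBlowupRescaledEnergy

/-!
# Crux `LandauTail.LandauTailBlowup` (stmt-NavierStokesRegularity-1944), line `registered`, cycle c7:
  stub `landauTail_core_radius_energy` — the CORE RADIUS, energy form

Helper file on the proof path of the crux item `stmt-NavierStokesRegularity-1944`
(`Summit.NavierStokesRegularity.NavierStokesRegularity.Theses.LandauTail.LandauTailBlowup`), lead c7: the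
registered support stub `landauTail_core_radius_energy` (L4), composed from the shell theorem
(`landauTail_shell_energy_floor`, p173525) and the rescaled energy bookkeeping (`landauTail_rescaled_energy_le`,
p172902).

THEOREM. For a nonzero steady `(−1)`-homogeneous profile `(U, P)` smooth off the origin there are `c, ε > 0` such
that for every classical unit-viscosity flow `u` on `ℝ³ × (−1,0)` with Tsai's energy bound `sup_t ∫_{B₁}|u|² ≤ C`,
at every scale `0 < λ ≤ 1`, the parabolic rescaling `u_λ(s,y) = λ u(λ²s, λy)` is NOT `L²`-close to the Landau
flow on any shell of radius `ρ ≤ 1` over a window `(s₁, s₂)` once `C ρ³ < c λ (s₂ − s₁)²`: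
`∫_{s₁}^{s₂}∫_{ρ/2<|y|<ρ} |u_λ − U|² > ε ρ (s₂ − s₁)`.

In physical variables: inside radius `∼ (c (s₂−s₁)²/C)^{1/3} λ^{4/3} = const · (T − t)^{2/3}` EVERY shell carries
an `L²`-deviation from the would-be Landau tail of at least a fixed fraction of Landau's own `L²`-mass there — the
energy half of STRATEGY-CENSUS §F3's core-radius window (`β ≤ 2/3`), for every flow and every scale, with no
limiting process.

PROOF. If the shell were close, the shell theorem gives a time `t ∈ [s₁, s₂]` with
`∫_{B_ρ}|u_λ(t)|² ≥ c (s₂−s₁)² ρ⁻³`, while the Tsai bound rescales to `∫_{B_ρ}|u_λ(t)|² ≤ C/λ`.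
-/

set_option linter.dupNamespace false

noncomputable section

open Filter Set Topology MeasureTheory Metric Function
open scoped ENNReal NNReal InnerProductSpace RealInnerProductSpace Laplacian ContDiff
open Literature.Analysis.FluidPDE

namespace Summit.NavierStokesRegularity.NavierStokesRegularity.Theorems

/-- The parabolic rescaling `u_λ = nsRescale λ u`, `0 < λ ≤ 1`, of a classical unit-viscosity flow on `(−1, 0)`
is again a classical unit-viscosity flow on `(−1, 0)` (scaling covariance,
`IsClassicalNSSolutionOn.nsRescale_holds`, restricted from `(−λ⁻², 0)`). [folklore] -/
theorem landauTail_coreRadius_nsRescale_classical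
    {u : ℝ → EuclideanSpace ℝ (Fin 3) → EuclideanSpace ℝ (Fin 3)} {p : ℝ → EuclideanSpace ℝ (Fin 3) → ℝ}
    (hcl : IsClassicalNSSolutionOn (Ioo (-1 : ℝ) 0) 1 0 u p) {lam : ℝ} (h0 : 0 < lam) (h1 : lam ≤ 1) :
    IsClassicalNSSolutionOn (Ioo (-1 : ℝ) 0) 1 0 (nsRescale lam u) (nsRescalePressure lam p) := by
  have key := IsClassicalNSSolutionOn.nsRescale_holds hcl h0
  rw [nsRescaleForce_zero] at key
  refine key.mono (fun t ht => ?_) (uniqueDiffOn_Ioo (-1) 0)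
  simp only [mem_preimage, mem_Ioo] at ht ⊢
  have h2 : lam ^ 2 ≤ 1 := pow_le_one₀ h0.le h1
  refine ⟨?_, mul_neg_of_pos_of_neg (pow_pos h0 2) ht.2⟩
  nlinarith [mul_nonneg (sub_nonneg.2 h2) (neg_nonneg.2 ht.2.le)]

/-- **L4 — CORE RADIUS, energy form** (registered support stub of crux stmt-NavierStokesRegularity-1944, lead c7):
for every profile there are `c, ε > 0` such that for every classical flow on `ℝ³ × (−1,0)` with Tsai's energy bound
`sup_t ∫_{B₁}|u|² ≤ C`, at every scale `0 < λ ≤ 1` the rescaling `u_λ` is NOT `L²`-close to the Landau flow on any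
shell of radius `ρ` with `C ρ³ < c λ (s₂ − s₁)²`. [folklore] -/
theorem landauTail_core_radius_energy : ∀ (U : EuclideanSpace ℝ (Fin 3) → EuclideanSpace ℝ (Fin 3)) (P : EuclideanSpace ℝ (Fin 3) → ℝ), (ContDiffOn ℝ (⊤ : ℕ∞) U {0}ᶜ ∧ ContDiffOn ℝ (⊤ : ℕ∞) P {0}ᶜ ∧ (∀ x : EuclideanSpace ℝ (Fin 3), x ≠ 0 → Literature.Analysis.FluidPDE.convect U U x + gradient P x = (1 : ℝ) • Laplacian.laplacian U x) ∧ (∀ x : EuclideanSpace ℝ (Fin 3), x ≠ 0 → Literature.Analysis.FluidPDE.VectorCalculus.divergence U x = 0) ∧ (∀ c : ℝ, 0 < c → ∀ x : EuclideanSpace ℝ (Fin 3), U (c • x) = c⁻¹ • U x) ∧ (∃ x : EuclideanSpace ℝ (Fin 3), U x ≠ 0)) → ∃ c : ℝ, 0 < c ∧ ∃ ε : ℝ, 0 < ε ∧ ∀ (u : ℝ → EuclideanSpace ℝ (Fin 3) → EuclideanSpace ℝ (Fin 3)) (p : ℝ → EuclideanSpace ℝ (Fin 3) → ℝ) (C :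 NNReal), Literature.Analysis.FluidPDE.IsClassicalNSSolutionOn (Set.Ioo (-1) 0) 1 0 u p → (∀ t ∈ Set.Ioo (-1 : ℝ) 0, ∫⁻ x in Metric.ball (0 : EuclideanSpace ℝ (Fin 3)) 1, ‖u t x‖ₑ ^ 2 ≤ C) → ∀ lam : ℝ, 0 < lam → lam ≤ 1 → ∀ ρ : ℝ, 0 < ρ → ρ ≤ 1 → ∀ s₁ s₂ : ℝ, -1 < s₁ → s₁ < s₂ → s₂ < 0 → (C : ℝ) * ρ ^ 3 < c * lam * (s₂ - s₁) ^ 2 → ENNReal.ofReal (ε * ρ * (s₂ - s₁)) < ∫⁻ z in Set.Ioo s₁ s₂ ×ˢ (Metric.ball (0 : EuclideanSpace ℝ (Fin 3)) ρ \ Metric.closedBall (0 : EuclideanSpace ℝ (Fin 3)) (ρ / 2)), ‖Literature.Analysis.FluidPDE.nsRescale lam u z.1 z.2 - U z.2‖ₑ ^ 2 := by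
  intro U P hprof
  obtain ⟨c, hc, ε, hε, hshell⟩ := landauTail_shell_energy_floor U P hprof
  refine ⟨c, hc, ε, hε, ?_⟩
  intro u p C hcl hC lam hlam0 hlam1 ρ hρ hρ1 s₁ s₂ hs₁ hs₁₂ hs₂ hsmall
  by_contra hnot
  rw [not_lt] at hnot
  have hv := landauTail_coreRadius_nsRescale_classical hcl hlam0 hlam1
  obtain ⟨t, ht, hE⟩ := hshell (nsRescale lam u) (nsRescalePressure lam p) hv ρ hρ hρ1 s₁ s₂ hs₁ hs₁₂ hs₂ hnot
  have ht' : t ∈ Ioo (-1 : ℝ) 0 := ⟨hs₁.trans_le ht.1, ht.2.trans_lt hs₂⟩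
  have hW5 := landauTail_rescaled_energy_le u C hC lam hlam0 hlam1 ρ hρ (by nlinarith) t ht'
  have hchain : ENNReal.ofReal (c * (s₂ - s₁) ^ 2 / ρ ^ 3) ≤ ENNReal.ofReal (lam⁻¹ * C) := by
    refine hE.trans (hW5.trans (le_of_eq ?_))
    rw [ENNReal.ofReal_mul (inv_nonneg.2 hlam0.le), ENNReal.ofReal_coe_nnreal]
  have hreal : c * (s₂ - s₁) ^ 2 / ρ ^ 3 ≤ lam⁻¹ * C :=
    (ENNReal.ofReal_le_ofReal_iff (by positivity)).1 hchain
  rw [div_le_iff₀ (by positivity)] at hreal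
  have : c * lam * (s₂ - s₁) ^ 2 ≤ (C : ℝ) * ρ ^ 3 := by
    have h := mul_le_mul_of_nonneg_left hreal hlam0.le
    calc c * lam * (s₂ - s₁) ^ 2 = lam * (c * (s₂ - s₁) ^ 2) := by ring
      _ ≤ lam * (lam⁻¹ * C * ρ ^ 3) := h
      _ = (C : ℝ) * ρ ^ 3 := by field_simp
  exact absurd hsmall (not_lt.2 this)

end Summit.NavierStokesRegularity.NavierStokesRegularity.Theorems

end
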